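import Mathlib

/-!
# T5GaussSumInert — the conductor-one Gauss sum of Lemma N5.L4(iii) (inert place)

Cell pub-hodge-repro2, Tier 5, sub-step N5 (route/T5-route-2.md v0.3 §N5.11, Lemma N5.L4(iii),
case `a(ξ) = 1`; re-derived in route/T5-CHECK-N5-p4.md §2.3); kernel support by seat p4.

At an inert place the residue field `K = k_E = 𝔽_{q²}` is a quadratic extension of `k = k_F = 𝔽_q`,
the reduction `ψ̄` of the additive character `ψ₀` is a non-trivial additive character of `K` which is
trivial on `k`, and the reduction `ξ̄` of a conjugate-symplectic character of conductor one is a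
non-trivial multiplicative character of `K` trivial on `k^×`.  The prose computes the Gauss sum

  `G = Σ_{x ∈ K^×} ξ̄^{-1}(x) ψ̄(x) = q`

(grouping by `k^×`-cosets and the subspace `L = {z : ψ̄(fz) = 1 ∀ f ∈ k} = k`), whence
`ε(ξ, ψ₀) = ξ(π_F)·q^{-1}·G = η_v(π_F) = −1`.  This file kernel-checks the Gauss-sum identity in the
abstract form (`k`, `K` finite fields, `K` a `k`-algebra of dimension `2`, `χ` a multiplicative
character of `K` that is non-trivial and trivial on `k^×`, `ψ` an additive character of `K` that is
non-trivial and trivial on `k`):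

* `sum_subfield_eq` : `Σ_{f ∈ k} ψ(f x) = q` if `x ∈ k`, `0` otherwise (the subspace `L = k`);
* `gaussSum_eq_card` : `gaussSum χ ψ = Σ_{x ∈ K} χ x ψ x = q` (Mathlib's `gaussSum`; `χ 0 = 0`).

The proof averages the Gauss sum over the multiplications by `f ∈ k^×` (which leave `χ` invariant)
instead of choosing coset representatives: `(q−1)·G = Σ_x χ(x)(Σ_{f ≠ 0} ψ(fx)) = Σ_x χ(x)(Σ_f ψ(fx) − 1)
= q·Σ_{x ∈ k} χ(x) − Σ_x χ(x) = q(q−1) − 0`.  Applied in the prose with `χ = ξ̄^{-1}` (non-trivial, trivial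
on `k^×` as `ξ̄` is).  Not modelled: the local field, the reduction maps, the prefactor `ξ(π_F)q^{-1}`.
-/

namespace Summit.Ventures.HodgeRepro2.T5GaussSumInert

open Finset

variable {k K : Type*} [Field k] [Field K] [Algebra k K] [Fintype k] [Fintype K] [DecidableEq K]

omit [Fintype k] [Fintype K] [DecidableEq K] in
/-- Every element of a `2`-dimensional `k`-algebra is `a + b x` once `x ∉ k`. -/
theorem exists_eq_add_mul_of_notMem_range (hrank : Module.finrank k K = 2) {x : K}
    (hx : x ∉ Set.range (algebraMap k K)) (y : K) :
    ∃ a b : k, y = algebraMap k K a + algebraMap k K b * x := by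
  have hli : LinearIndependent k ![(1 : K), x] := by
    rw [LinearIndependent.pair_iff' one_ne_zero]
    intro a ha
    exact hx ⟨a, by rw [Algebra.algebraMap_eq_smul_one, ha]⟩
  have hspan : Submodule.span k (Set.range ![(1 : K), x]) = ⊤ :=
    hli.span_eq_top_of_card_eq_finrank (by simp [hrank])
  have hy : y ∈ Submodule.span k (Set.range ![(1 : K), x]) := by rw [hspan]; exact trivial
  rw [Matrix.range_cons_cons_empty, Submodule.mem_span_pair] at hy
  obtain ⟨a, b, hab⟩ := hy
  exact ⟨a, b, by rw [← hab, Algebra.smul_def, Algebra.smul_def, mul_one]⟩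

omit [Fintype K] in
/-- **The subspace `L = k`**: for `ψ` non-trivial on `K` and trivial on `k`,
`Σ_{f ∈ k} ψ (f x) = |k|` when `x ∈ k` and `0` otherwise. -/
theorem sum_subfield_eq (hrank : Module.finrank k K = 2) (ψ : AddChar K ℂ) (hψ : ψ ≠ 1)
    (hψk : ∀ f : k, ψ (algebraMap k K f) = 1) (x : K) :
    ∑ f : k, ψ (algebraMap k K f * x)
      = if x ∈ Set.range (algebraMap k K) then (Fintype.card k : ℂ) else 0 := by
  -- the additive character `f ↦ ψ (f x)` of `k`
  set ψx : AddChar k ℂ :=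
    ψ.compAddMonoidHom ((AddMonoidHom.mulRight x).comp (algebraMap k K).toAddMonoidHom) with hψx
  have hψx_apply : ∀ f : k, ψx f = ψ (algebraMap k K f * x) := fun f => rfl
  simp_rw [← hψx_apply]
  split_ifs with hxk
  · obtain ⟨a, rfl⟩ := hxk
    have : ψx = 1 := by
      ext f
      rw [hψx_apply, ← map_mul, hψk, AddChar.one_apply]
    exact AddChar.sum_eq_card_of_eq_one this
  · apply AddChar.sum_eq_zero_of_ne_one
    intro h1
    apply hψ
    ext y
    obtain ⟨a, b, rfl⟩ := exists_eq_add_mul_of_notMem_range hrank hxk y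
    have hb : ψ (algebraMap k K b * x) = 1 := by
      rw [← hψx_apply, h1, AddChar.one_apply]
    rw [AddChar.map_add_eq_mul, hψk, hb, one_mul, AddChar.one_apply]

omit [Fintype k] [DecidableEq K] in
/-- Multiplying the variable by `f ∈ k^×` does not change the Gauss sum when `χ` is trivial on
`k^×`. -/
theorem sum_mul_eq_gaussSum (χ : MulChar K ℂ) (ψ : AddChar K ℂ)
    (hχk : ∀ f : k, f ≠ 0 → χ (algebraMap k K f) = 1) {f : k} (hf : f ≠ 0) :
    ∑ x : K, χ x * ψ (algebraMap k K f * x) = gaussSum χ ψ := by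
  have hu : IsUnit (algebraMap k K f) := by
    rw [isUnit_iff_ne_zero]
    exact (map_ne_zero _).mpr hf
  have hbij : Function.Bijective fun x : K => algebraMap k K f * x := hu.unit.mulLeft_bijective
  rw [gaussSum]
  exact Fintype.sum_bijective _ hbij _ _ fun x => by simp only [map_mul, hχk f hf, one_mul]

/-- **The conductor-one Gauss sum** of N5.L4(iii): `Σ_{x ∈ K} χ(x) ψ(x) = |k|` for `χ` non-trivial
and trivial on `k^×`, `ψ` non-trivial and trivial on `k`, `[K : k] = 2`. -/
theorem gaussSum_eq_card (hrank : Module.finrank k K = 2) (χ : MulChar K ℂ) (ψ : AddChar K ℂ)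
    (hχ : χ ≠ 1) (hχk : ∀ f : k, f ≠ 0 → χ (algebraMap k K f) = 1) (hψ : ψ ≠ 1)
    (hψk : ∀ f : k, ψ (algebraMap k K f) = 1) :
    gaussSum χ ψ = Fintype.card k := by
  classical
  set q : ℂ := (Fintype.card k : ℂ) with hq
  have hq1 : q - 1 ≠ 0 := by
    have h2 : Fintype.card k ≠ 1 := (Fintype.one_lt_card).ne'
    have : q ≠ 1 := by rw [hq]; exact_mod_cast h2
    exact sub_ne_zero.mpr this
  -- average over `f ∈ k^×`
  have hav : (q - 1) * gaussSum χ ψ = ∑ x : K, χ x * (∑ f : k, ψ (algebraMap k K f * x) - 1) := by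
    have h1 : ∑ f ∈ (univ : Finset k).erase 0, gaussSum χ ψ = (q - 1) * gaussSum χ ψ := by
      rw [sum_const, card_erase_of_mem (mem_univ _), card_univ, nsmul_eq_mul, hq]
      push_cast [Nat.one_le_iff_ne_zero.mpr Fintype.card_ne_zero]
      ring
    rw [← h1]
    calc ∑ f ∈ (univ : Finset k).erase 0, gaussSum χ ψ
        = ∑ f ∈ (univ : Finset k).erase 0, ∑ x : K, χ x * ψ (algebraMap k K f * x) :=
          sum_congr rfl fun f hf => (sum_mul_eq_gaussSum χ ψ hχk (ne_of_mem_erase hf)).symm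
      _ = ∑ x : K, χ x * ∑ f ∈ (univ : Finset k).erase 0, ψ (algebraMap k K f * x) := by
          rw [sum_comm]
          simp_rw [mul_sum]
      _ = ∑ x : K, χ x * (∑ f : k, ψ (algebraMap k K f * x) - 1) := by
          refine sum_congr rfl fun x _ => ?_
          congr 1
          rw [← add_sum_erase _ _ (mem_univ (0 : k))]
          simp
  -- evaluate the inner sums with `sum_subfield_eq`
  have hval : ∑ x : K, χ x * (∑ f : k, ψ (algebraMap k K f * x) - 1) = q * (q - 1) := by
    have hfilter : (univ : Finset K).filter (fun x => x ∈ Set.range (algebraMap k K))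
        = univ.image (algebraMap k K) := by
      ext x; simp [Set.mem_range, eq_comm]
    have hsum0 : ∑ x : K, χ x * (if x ∈ Set.range (algebraMap k K) then q else 0)
        = ∑ a : k, χ (algebraMap k K a) * q := by
      simp_rw [mul_ite, mul_zero]
      rw [← sum_filter, hfilter, sum_image (fun a _ b _ h => (algebraMap k K).injective h)]
    have hsum1 : ∑ a : k, χ (algebraMap k K a) * q = (q - 1) * q := by
      rw [← add_sum_erase _ _ (mem_univ (0 : k)), map_zero, MulChar.map_zero, zero_mul, zero_add,
        sum_congr rfl (fun a ha => by rw [hχk a (ne_of_mem_erase ha), one_mul]), sum_const,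
        card_erase_of_mem (mem_univ _), card_univ, nsmul_eq_mul, hq]
      push_cast [Nat.one_le_iff_ne_zero.mpr Fintype.card_ne_zero]
      ring
    simp_rw [sum_subfield_eq hrank ψ hψ hψk, mul_sub, sum_sub_distrib, mul_one,
      MulChar.sum_eq_zero_of_ne_one hχ, sub_zero]
    rw [hsum0, hsum1]
    ring
  have key : (q - 1) * gaussSum χ ψ = (q - 1) * q := by rw [hav, hval]; ring
  exact mul_left_cancel₀ hq1 key

end Summit.Ventures.HodgeRepro2.T5GaussSumInert
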